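import Literature.NumberTheory.EllipticCurves.CuspFormLFunctionLevelConductorOfCarayolProofs
import Literature.NumberTheory.EllipticCurves.NewformGaloisRepEulerFactors
import Literature.NumberTheory.DiophantineGeometry.ConductorAdditiveProofs
import Literature.NumberTheory.Automorphic.CDTTheorem722
import Literature.NumberTheory.Automorphic.BCDTModularity
import HarnessLib

/-!
# stub-ideation k3 (gen 5, FAMILY 3 — probe the extremes) for `stub_threeImpTwo` (S9) of crux
`FreyModularity` (stmt-ABC-11340), line `Sketch` — companion to `STUB-IDEAS-stub_threeImpTwo-3.md`

Gen 5 adds ONE structural fact to the k1/k2/k3 gen-1–4 packet road (k2 gen 4: a.e. PACKET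
`(f₀ ∈ S₂(Γ₀(N)) newform, W good off N, a_p(f₀) = a_p(W) for p ∤ N)` — PROVED from two primes by
k2's `exists_isNewform0_packet_off_level_of_two_primes`; then M3 `IsNewformOf W f₀` from
`Carayol1986_eulerFactor` (C_E), then `N = N_W` from the level fact `hC` ⇐ Carayol (A) + Saito at 2):

**EXTREMAL SPLIT OF THE BAD EULER FACTORS.**  Run the level leaf FIRST, on the packet itself:
`N = N_W` follows from Carayol's CONDUCTOR theorem `Carayol1986_artinConductorExponent` (C_A) and
Saito's `p = 2` leaf, with NO Euler-factor input (L0 below = the tree's Galois road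
`IsNewformOf.level_eq_conductorNorm_of_carayol_of_saito` with `IsNewformOf` weakened to the packet —
its proof only ever used `a_p` at `p ∤ N`).  Once `N = N_W`, the minimal `n` with `aₙ(f₀) ≠ aₙ(W)` is
forced to be a prime `p ∥ N` (both sequences are multiplicative and satisfy the same `p`-power
recursions; at `p² ∣ N = N_W` both `a_p` vanish — Atkin–Lehner Thm. 3 / additive reduction), where
`a_p(f₀) = -λ_p(f₀) ∈ {±1}` and `a_p(W) ∈ {±1}` (split / non-split): the ONLY datum of C_E the stub
needs is this STEINBERG SIGN BIT (L2 `SteinbergSignPacket`, = Darmon–Diamond–Taylor Thm. 3.1 (e),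
first case, read on `V_ℓ W`; ⇐ C_E by k1's proved H3/H4 at the single place `v ∣ p`).  L1 is the
elementary assembly.  Closing set for S9 along k2's CS recut becomes
{C_A, Saito-at-2 (gen-4 k3 residual `SaitoTwoSupersingular`), SteinbergSignPacket} — no
Eichler–Shimura, no C_E, no separate `hC`.

* L0a `exists_isGaloisRepOfNewform1_rationalTate_of_packet` — `V_ℓ W ⊗ ℚ̄_ℓ` is an irreducible
  representation attached to the `Γ₁(N)`-lift of `f₀` away from `N ℓ`, with Artin exponents `a_w(V_ℓ W)`
  (port of the tree's `IsNewformOf.exists_isGaloisRepOfNewform1_rationalTate`; PROVED);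
* L0b/L0c `padicValNat_level_eq_conductorExponent_of_carayol1986_of_packet`,
  `level_eq_conductorNorm_of_carayol1986_of_saito_of_packet` (+ the `¬ additive at 2` variant) —
  `N = N_W` for the packet (PROVED modulo the named facts, as hypotheses);
* L1 `isNewformOf_of_packet_of_level_eq_of_sign` — packet + `N = N_W` + sign at `p ∥ N` ⇒
  `IsNewformOf W f₀` (PROVED, elementary);
* L2 `SteinbergSignPacket` (the residual, typed) and L2a `steinbergSignPacket_of_carayol1986_eulerFactor`
  (`sorry`: corollary of k1's PROVED `isNewformOf_of_cofinalAt_of_carayolEuler ∘ ratGaloisRepCofinalAt_of_curve`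
  in `STUB_IDEAS_stub_threeImpTwo_1_Sketch.lean`, which cannot be imported here);
* closers `isNewformOf_of_packet_of_carayol1986_of_saito_of_sign`, `isModular_of_packet_of_carayol1986_of_saito_of_sign`,
  `SomeLevelPacket` (realisation leaf, k2-merge / k1-hole-filler shape) and `stub_threeImpTwo_of_packet_leaves`
  (the VERBATIM stub from {SomeLevelPacket, C_A, Saito leaf, SteinbergSignPacket}; PROVED).

[cite: CarayolASENS1986, Thm. (A), (0.8) Corollaire (pp. 410–411)]
[cite: DarmonDiamondTaylor1995, Thm. 3.1 (d), (e) (pp. 86–87)] [cite: Saito1988, Theorem 1]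
[cite: AtkinLehner1970, Thm. 3] [cite: DiamondShurman2005, Thm. 8.8.1, §8.8 (8.43)–(8.44)]
[cite: BCDTJAMS2001, Introduction ((3) ⇒ (2))]
-/

noncomputable section

open scoped NumberField Polynomial MatrixGroups ModularForm
open NumberField IsDedekindDomain Field Polynomial Matrix Rat.HeightOneSpectrum CongruenceSubgroup
  Literature.NumberTheory.GaloisRepresentations Literature.NumberTheory.EllipticCurves
  Literature.NumberTheory.EllipticCurves.ModularForms Literature.NumberTheory.Automorphic
  WeierstrassCurve

namespace Summit.ABC.ABC.Cruxes.FreyModularity.Sketch.ThreeImpTwoIdeas3g5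

/-! ## L0 — the level leaf on the PACKET (Carayol (A) + Saito at `2`; no Euler factors) -/

section LevelLeaf

variable (W : WeierstrassCurve ℚ) [W.IsElliptic] {N : ℕ} [NeZero N] (f₀ : CuspForm (Gamma0 N) 2)

omit [W.IsElliptic] in
/-- A `Γ₀(N)`-newform is not the zero form (`a₁ = 1`). [folklore] -/
theorem ne_zero_of_isNewform0 (hf₀ : IsNewform0 f₀) : f₀ ≠ 0 := by
  intro h0
  have h1 : cuspCoeff f₀ 1 = 1 := hf₀.2.2
  rw [h0, cuspCoeff, CuspForm.coe_zero, UpperHalfPlane.qExpansion_zero, map_zero] at h1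
  exact zero_ne_one h1

omit [W.IsElliptic] in
/-- **The Hecke polynomial of the `Γ₁(N)`-lift of `f₀` at a prime `q ∤ N` carrying `a_q(W)`**, read in
`ℚ̄_ℓ`: `X² - a_q(W) X + q` (the tree's private `IsNewformOf.map_heckePolynomial_liftToGamma1` with
`IsNewformOf` weakened to the single coefficient `a_q(f₀) = a_q(W)`). [folklore] -/
theorem map_heckePolynomial_liftToGamma1_of_cuspCoeff_eq (hne : f₀ ≠ 0) (ℓ : ℕ) [Fact ℓ.Prime]
    (ι : PadicAlgCl ℓ ≃+* ℂ) {q : ℕ} (hq : q.Prime) (hqN : ¬ q ∣ N)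
    (ha : cuspCoeff f₀ q = (W.LFunction q : ℂ)) :
    (heckePolynomial (liftToGamma1 N 2 f₀) q).map
        ((ι.symm : ℂ →+* PadicAlgCl ℓ).comp (algebraMap (coeffCharField (liftToGamma1 N 2 f₀)) ℂ)) =
      X ^ 2 - C ((W.LFunction q : ℤ) : PadicAlgCl ℓ) * X + C ((q : ℕ) : PadicAlgCl ℓ) := by
  rw [← Polynomial.map_map, map_heckePolynomial, coe_liftToGamma1_holds N 2 f₀]
  have ha' : (UpperHalfPlane.qExpansion 1 ⇑f₀).coeff q = (W.LFunction q : ℂ) := ha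
  have hε : nebentypus (liftToGamma1 N 2 f₀) (q : ZMod N) = 1 := by
    rw [nebentypus_liftToGamma1_holds N 2 hne,
      MulChar.one_apply ((ZMod.isUnit_prime_iff_not_dvd hq).mpr hqN)]
  rw [ha', hε]
  have h21 : ((2 : ℤ) - 1) = 1 := by norm_num
  simp [Polynomial.map_sub, Polynomial.map_add, Polynomial.map_mul, h21]

/-- **L0a — the `ℓ`-adic Tate module of `W` is an irreducible `ℓ`-adic representation attached to the
lift of the PACKET newform `f₀`.**  For an elliptic `W/ℚ`, a newform `f₀ ∈ S₂(Γ₀(N))` with `W` good off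
`N` and `a_p(f₀) = a_p(W)` for every prime `p ∤ N` (k2's packet; NO hypothesis at `p ∣ N`), a prime `ℓ`
with `V_ℓ W` irreducible and `ι : ℚ̄_ℓ ≃ ℂ`: a framed model of `V_ℓ W ⊗ ℚ̄_ℓ` is attached to
`liftToGamma1 N 2 f₀` away from `N ℓ`, is irreducible, and has Artin exponent `a_w(V_ℓ W)` at every
`w ∤ ℓ`.  Port of the tree's `IsNewformOf.exists_isGaloisRepOfNewform1_rationalTate`
(`CuspFormLFunctionLevelConductorCarayolProofs`), whose proof used `IsNewformOf` only through
`a_q(f) = a_q(W)` and good reduction at `q ∤ N`.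
[cite: DarmonDiamondTaylor1995, Thm. 3.1 (b), (c) and p. 87] [cite: SilvermanAEC2009, C.21 Remark 21.3] -/
theorem exists_isGaloisRepOfNewform1_rationalTate_of_packet (hf₀ : IsNewform0 f₀)
    (hgood : ∀ v : HeightOneSpectrum (𝓞 ℚ), ¬ ((primesEquiv v : ℕ) ∣ N) → W.HasGoodReductionAt v)
    (hap : ∀ p : ℕ, p.Prime → ¬ p ∣ N → cuspCoeff f₀ p = (W.LFunction p : ℂ))
    (ℓ : ℕ) [Fact ℓ.Prime] (ι : PadicAlgCl ℓ ≃+* ℂ)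
    (hirr : (W.rationalGaloisRepTate ℓ).IsIrreducible) :
    ∃ ρ : FramedGaloisRep ℚ (PadicAlgCl ℓ) 2,
      IsGaloisRepOfNewform1 (liftToGamma1 N 2 f₀)
          ((ι.symm : ℂ →+* PadicAlgCl ℓ).comp (algebraMap (coeffCharField (liftToGamma1 N 2 f₀)) ℂ))
          {q | q ∣ N * ℓ} ρ ∧
        ρ.toGaloisRep.IsIrreducible ∧
        ∀ w : HeightOneSpectrum (𝓞 ℚ), (ℓ : 𝓞 ℚ) ∉ w.asIdeal →
          ρ.toGaloisRep.artinConductorExponent w =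
            conductorExponentOf (WeierstrassCurve.geomPoints W) ℓ
              (W.continuous_rationalGaloisRepTate_holds ℓ) w := by
  classical
  have hℓp : ℓ.Prime := Fact.out
  have hne : f₀ ≠ 0 := ne_zero_of_isNewform0 f₀ hf₀
  obtain ⟨VQ, eV, heV, hV⟩ := exists_framedGaloisRep_rationalTate W ℓ
  set iE := algebraMap ℚ_[ℓ] (PadicAlgCl ℓ) with hiE
  have hiEc : Continuous iE := continuous_algebraMap_padicAlgCl ℓ
  have hcW := W.continuous_rationalGaloisRepTate_holds ℓ
  have heV' : ∀ (g : absoluteGaloisGroup ℚ) (x : Fin 2 → ℚ_[ℓ]),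
      eV (VQ.toGaloisRep g x) =
        rationalTateGaloisRepOf (WeierstrassCurve.geomPoints W) ℓ hcW g (eV x) := heV
  refine ⟨FramedRep.baseChange iE hiEc VQ, ?_, ?_, ?_⟩
  · -- attached to the lift of `f₀` away from `N ℓ`
    intro v hvS
    set q : ℕ := ((primesEquiv v : Nat.Primes) : ℕ) with hqdef
    have hq : q.Prime := (primesEquiv v).2
    simp only [Set.mem_setOf_eq] at hvS
    have hqN : ¬ q ∣ N := fun h ↦ hvS (h.trans (dvd_mul_right N ℓ))
    have hqℓ : q ≠ ℓ := fun h ↦ hvS (h ▸ dvd_mul_left q N)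
    have hℓv : (ℓ : 𝓞 ℚ) ∉ v.asIdeal := by
      rw [Rat.natCast_mem_asIdeal_iff]
      intro h
      exact hqℓ ((Nat.prime_dvd_prime_iff_eq hq hℓp).mp h)
    have hgoodv : W.HasGoodReductionAt v := hgood v hqN
    obtain ⟨hVu, hVf⟩ := hV v hℓv hgoodv
    refine ⟨(FramedGaloisRep.isUnramifiedAt_baseChange_iff iE hiEc iE.injective v VQ).mpr hVu, ?_⟩
    rw [map_heckePolynomial_liftToGamma1_of_cuspCoeff_eq W f₀ hne ℓ ι hq hqN (hap q hq hqN)]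
    have hVf' := FramedGaloisRep.hasFrobCharpolyAt_baseChange iE hiEc hVf
    have hmapQ : (X ^ 2 - C ((W.LFunction q : ℤ) : ℚ_[ℓ]) * X + C (q : ℚ_[ℓ]) : ℚ_[ℓ][X]).map iE =
        X ^ 2 - C ((W.LFunction q : ℤ) : PadicAlgCl ℓ) * X + C (q : PadicAlgCl ℓ) := by
      simp
    rw [hmapQ] at hVf'
    exact hVf'
  · -- irreducible: `V_ℓ W` is odd and irreducible, hence absolutely irreducible
    have hirrQ : FramedRep.IsIrreducible VQ :=
      (Representation.isIrreducible_iff_of_equivariant VQ.toRepresentation (W.rationalGaloisRepTate ℓ)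
        (MonoidHom.id _) Function.surjective_id eV heV).mpr hirr
    obtain ⟨c, hc⟩ := exists_isComplexConjugation (Rat.castHom ℝ)
    have hcc : c * c = 1 := by rw [← pow_two]; exact hc.sq_eq_one
    have hdet : Matrix.GeneralLinearGroup.det (VQ c) = -1 := by
      apply Units.ext
      rw [Matrix.GeneralLinearGroup.val_det_apply, Units.val_neg, Units.val_one]
      have h1 : ((VQ c : GL (Fin 2) ℚ_[ℓ]) : Matrix (Fin 2) (Fin 2) ℚ_[ℓ]).det =
          LinearMap.det (VQ.toRepresentation c) := by
        rw [← LinearMap.det_toLin']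
        rfl
      have h2 : LinearMap.det (VQ.toRepresentation c) =
          LinearMap.det (W.rationalGaloisRepTate ℓ c) := by
        have hconj : (W.rationalGaloisRepTate ℓ c : W.rationalTateModule ℓ →ₗ[ℚ_[ℓ]] _) =
            (eV : (Fin 2 → ℚ_[ℓ]) →ₗ[ℚ_[ℓ]] W.rationalTateModule ℓ) ∘ₗ VQ.toRepresentation c ∘ₗ
              (eV.symm : W.rationalTateModule ℓ →ₗ[ℚ_[ℓ]] (Fin 2 → ℚ_[ℓ])) := by
          apply LinearMap.ext
          intro y
          simp only [LinearMap.coe_comp, LinearEquiv.coe_coe, Function.comp_apply]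
          rw [heV, LinearEquiv.apply_symm_apply]
        rw [hconj, LinearMap.det_conj]
      rw [h1, h2, Literature.AlgebraicGeometry.Motives.det_rationalGaloisRepTate_eq_cyclotomicCharacter
        W ℓ c, GaloisRep.cyclotomicCharacter_of_isComplexConjugation ℓ hc, map_neg, map_one]
    have habs : FramedRep.IsAbsolutelyIrreducible VQ :=
      FramedRep.isAbsolutelyIrreducible_of_isIrreducible_of_det_eq_neg_one VQ hirrQ two_ne_zero hcc
        hdet
    exact habs (PadicAlgCl ℓ) iE
  · -- conductor exponents away from `ℓ`
    intro w _
    rw [FramedGaloisRep.artinConductorExponent_toGaloisRep_baseChange]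
    exact GaloisRep.artinConductorExponent_eq_of_equiv VQ.toGaloisRep
      (rationalTateGaloisRepOf (WeierstrassCurve.geomPoints W) ℓ hcW) eV heV' w

/-- **L0b — `v_q(N) = f_w(W)` for the packet at every prime `q` away from the additive places of
residue characteristic `2`, granted Carayol's conductor theorem** (the named fact
`Carayol1986_artinConductorExponent`, Carayol 1986 Thm. (A) / Darmon–Diamond–Taylor Thm. 3.1 (d)):
choose `ℓ > q` with `V_ℓ W` irreducible (`exists_prime_gt_isIrreducible_rationalGaloisRepTate`), apply
L0a and read `a_w(V_ℓ W) = f_w(W)` by Ogg's formula in Galois form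
(`conductorExponentOf_geomPoints_eq_conductorExponent_of_ringChar_two_imp`).
[cite: CarayolASENS1986, Thm. (A), (0.8) Corollaire (pp. 410–411)]
[cite: DarmonDiamondTaylor1995, Thm. 3.1 (d) with §2.1 (p. 54)] [cite: SilvermanATAEC1994, Thm. IV.10.2, IV.11.1] -/
theorem padicValNat_level_eq_conductorExponent_of_carayol1986_of_packet
    (hC : Carayol1986_artinConductorExponent) (hf₀ : IsNewform0 f₀)
    (hgood : ∀ v : HeightOneSpectrum (𝓞 ℚ), ¬ ((primesEquiv v : ℕ) ∣ N) → W.HasGoodReductionAt v)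
    (hap : ∀ p : ℕ, p.Prime → ¬ p ∣ N → cuspCoeff f₀ p = (W.LFunction p : ℂ))
    {q : ℕ} (hq : q.Prime) (w : HeightOneSpectrum (𝓞 ℚ)) (hqw : (q : 𝓞 ℚ) ∈ w.asIdeal)
    (h2 : ringChar (𝓞 ℚ ⧸ w.asIdeal) = 2 → ¬ W.HasAdditiveReductionAt w) :
    padicValNat q N = W.conductorExponent w := by
  obtain ⟨ℓ, hℓ, hqℓ, hirr⟩ := W.exists_prime_gt_isIrreducible_rationalGaloisRepTate q
  haveI := hℓ
  obtain ⟨ι⟩ := PadicAlgCl.nonempty_ringEquiv_complex ℓ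
  obtain ⟨ρ, hρ, hirrρ, hcond⟩ :=
    exists_isGaloisRepOfNewform1_rationalTate_of_packet W f₀ hf₀ hgood hap ℓ ι hirr
  have hnew : IsNewform1 (liftToGamma1 N 2 f₀) := (isNewform1_liftToGamma1_iff_holds N 2 f₀).mpr hf₀
  have hqw' : natGenerator w = q :=
    (Nat.prime_dvd_prime_iff_eq (primesEquiv w).2 hq).mp ((Rat.natCast_mem_asIdeal_iff w).mp hqw)
  have hℓw : (ℓ : 𝓞 ℚ) ∉ w.asIdeal := by
    rw [Rat.natCast_mem_asIdeal_iff, hqw']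
    intro h
    exact (ne_of_lt hqℓ) ((Nat.prime_dvd_prime_iff_eq hq hℓ.out).mp h)
  have key := hC (liftToGamma1 N 2 f₀) le_rfl hnew ℓ ι ρ hρ hirrρ q hq (ne_of_lt hqℓ) w hqw
  rw [← key, hcond w hℓw]
  exact W.conductorExponentOf_geomPoints_eq_conductorExponent_of_ringChar_two_imp ℓ _ w hℓw h2

omit [NeZero N] in
/-- `N = N_W` exponentwise (copy of the tree's private
`eq_conductorNorm_of_forall_padicValNat_eq_conductorExponent`). [folklore] -/
theorem eq_conductorNorm_of_forall_padicValNat_eq_conductorExponent' (hN : N ≠ 0)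
    (h : ∀ q : ℕ, q.Prime → ∀ w : HeightOneSpectrum (𝓞 ℚ), (q : 𝓞 ℚ) ∈ w.asIdeal →
      padicValNat q N = W.conductorExponent w) :
    N = W.conductorNorm ℤ := by
  refine Nat.eq_of_factorization_eq hN (W.conductorNorm_pos_holds).ne' fun q ↦ ?_
  by_cases hq : q.Prime
  · set q' : Nat.Primes := ⟨q, hq⟩ with hq'
    set w : HeightOneSpectrum (𝓞 ℚ) := (primesEquiv (R := 𝓞 ℚ)).symm q' with hw
    have hpw : (primesEquiv w : Nat.Primes) = q' := Equiv.apply_symm_apply _ _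
    have hqw : (q : 𝓞 ℚ) ∈ w.asIdeal :=
      (Rat.natCast_mem_asIdeal_iff w).mpr (by rw [show natGenerator w = q from congrArg Subtype.val hpw])
    have hgen : natGenerator ((primesEquiv (R := ℤ)).symm q') = q :=
      congrArg (fun x : Nat.Primes ↦ (x : ℕ)) (Equiv.apply_symm_apply (primesEquiv (R := ℤ)) q')
    rw [Nat.factorization_def _ hq, h q hq w hqw, W.conductorExponent_ringOfIntegers_eq w,
      ← W.factorization_conductorNorm_holds ((primesEquiv (R := ℤ)).symm (primesEquiv w)), hpw, hgen]
  · rw [Nat.factorization_eq_zero_of_not_prime _ hq, Nat.factorization_eq_zero_of_not_prime _ hq]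

/-- **L0c — level `=` conductor for the PACKET, for a curve not additive at `2`, modulo Carayol (A)
alone.** [cite: CarayolASENS1986, Thm. (A), (0.8) Corollaire] [cite: DarmonDiamondTaylor1995, Thm. 3.1 (d)] -/
theorem level_eq_conductorNorm_of_carayol1986_of_packet_of_not_additive_two
    (hC : Carayol1986_artinConductorExponent) (hf₀ : IsNewform0 f₀)
    (hgood : ∀ v : HeightOneSpectrum (𝓞 ℚ), ¬ ((primesEquiv v : ℕ) ∣ N) → W.HasGoodReductionAt v)
    (hap : ∀ p : ℕ, p.Prime → ¬ p ∣ N → cuspCoeff f₀ p = (W.LFunction p : ℂ))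
    (h2 : ∀ w : HeightOneSpectrum (𝓞 ℚ), ringChar (𝓞 ℚ ⧸ w.asIdeal) = 2 →
      ¬ W.HasAdditiveReductionAt w) :
    N = W.conductorNorm ℤ :=
  eq_conductorNorm_of_forall_padicValNat_eq_conductorExponent' W (NeZero.ne N) fun _ hq w hqw ↦
    padicValNat_level_eq_conductorExponent_of_carayol1986_of_packet W f₀ hC hf₀ hgood hap hq w hqw (h2 w)

/-- **L0c' — level `=` conductor for the PACKET, for EVERY elliptic `W/ℚ`, modulo Carayol (A) and
Saito's `p = 2` leaf of Ogg's formula for `W`** (the named fact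
`W.swanConductorAt_rationalTate_eq_wildConductorExponent_of_ringChar_eq_two ℓ`, Saito 1988; for `W`
with `ord₂ j ≤ 0` a theorem of the tree, in general gen-4 k3's residual `SaitoTwoSupersingular`).
[cite: CarayolASENS1986, Thm. (A), (0.8) Corollaire] [cite: Saito1988, Theorem 1]
[cite: DiamondShurman2005, Thm. 8.8.1] -/
theorem level_eq_conductorNorm_of_carayol1986_of_saito_of_packet
    (hC : Carayol1986_artinConductorExponent)
    (hS : ∀ (ℓ : ℕ) [Fact ℓ.Prime],
      W.swanConductorAt_rationalTate_eq_wildConductorExponent_of_ringChar_eq_two ℓ)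
    (hf₀ : IsNewform0 f₀)
    (hgood : ∀ v : HeightOneSpectrum (𝓞 ℚ), ¬ ((primesEquiv v : ℕ) ∣ N) → W.HasGoodReductionAt v)
    (hap : ∀ p : ℕ, p.Prime → ¬ p ∣ N → cuspCoeff f₀ p = (W.LFunction p : ℂ)) :
    N = W.conductorNorm ℤ := by
  refine eq_conductorNorm_of_forall_padicValNat_eq_conductorExponent' W (NeZero.ne N)
    fun q hq w hqw ↦ ?_
  obtain ⟨ℓ, hℓ, hqℓ, hirr⟩ := W.exists_prime_gt_isIrreducible_rationalGaloisRepTate q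
  haveI := hℓ
  obtain ⟨ι⟩ := PadicAlgCl.nonempty_ringEquiv_complex ℓ
  obtain ⟨ρ, hρ, hirrρ, hcond⟩ :=
    exists_isGaloisRepOfNewform1_rationalTate_of_packet W f₀ hf₀ hgood hap ℓ ι hirr
  have hnew : IsNewform1 (liftToGamma1 N 2 f₀) := (isNewform1_liftToGamma1_iff_holds N 2 f₀).mpr hf₀
  have hqw' : natGenerator w = q :=
    (Nat.prime_dvd_prime_iff_eq (primesEquiv w).2 hq).mp ((Rat.natCast_mem_asIdeal_iff w).mp hqw)
  have hℓw : (ℓ : 𝓞 ℚ) ∉ w.asIdeal := by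
    rw [Rat.natCast_mem_asIdeal_iff, hqw']
    intro h
    exact (ne_of_lt hqℓ) ((Nat.prime_dvd_prime_iff_eq hq hℓ.out).mp h)
  have key := hC (liftToGamma1 N 2 f₀) le_rfl hnew ℓ ι ρ hρ hirrρ q hq (ne_of_lt hqℓ) w hqw
  rw [← key, hcond w hℓw]
  exact W.artinConductorExponent_tate_eq_conductorExponent_of_isElliptic_of_two ℓ (hS ℓ) _ w hℓw

end LevelLeaf

/-! ## L1 — the elementary assembly: packet + `N = N_W` + the sign at `p ∥ N` ⇒ `IsNewformOf` -/

section Assembly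

variable (W : WeierstrassCurve ℚ) [W.IsElliptic] {N : ℕ} [NeZero N] (f₀ : CuspForm (Gamma0 N) 2)

/-- **L1 — EXTREMAL SPLIT (elementary).**  For an elliptic `W/ℚ` and a newform `f₀ ∈ S₂(Γ₀(N))` at
level `N = N_W` with `a_p(f₀) = a_p(W)` at every prime `p ∤ N` AND at every prime `p ∥ N`, one has
`aₙ(f₀) = aₙ(W)` for all `n` (`IsNewformOf W f₀`): at `p² ∣ N` both sides vanish (`a_p(f₀) = 0`,
Atkin–Lehner Thm. 3, `IsNewform0.cuspCoeff_eq_zero_of_sq_dvd`; `p² ∣ N_W ⇔` additive reduction,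
Silverman ATAEC IV.10.2 (c), `two_le_conductorExponent_iff_holds`, and `a_p(W) = 0` there,
`LFunction_apply_eq_zero_of_hasAdditiveReductionAt`), and the two multiplicative sequences with equal
prime values and the same prime-power recursions coincide (`isNewformOf_of_forall_prime_cuspCoeff_eq`,
Diamond–Shurman (8.43)–(8.44)).  So the minimal `n` with `aₙ(f₀) ≠ aₙ(W)` is a prime `p ∥ N`, where
both values are signs.  [cite: AtkinLehner1970, Thm. 3] [cite: DiamondShurman2005, §8.8 (8.43)–(8.44), Thm. 8.8.3]
[cite: SilvermanATAEC1994, Thm. IV.10.2] -/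
theorem isNewformOf_of_packet_of_level_eq_of_sign (hf₀ : IsNewform0 f₀) (hN : N = W.conductorNorm ℤ)
    (hap : ∀ p : ℕ, p.Prime → ¬ p ∣ N → cuspCoeff f₀ p = (W.LFunction p : ℂ))
    (hsign : ∀ p : ℕ, p.Prime → p ∣ N → ¬ p ^ 2 ∣ N → cuspCoeff f₀ p = (W.LFunction p : ℂ)) :
    IsNewformOf W f₀ := by
  subst hN
  refine isNewformOf_of_forall_prime_cuspCoeff_eq (fun u ↦ conductorExponent_eq_zero_iff_holds u W)
    hf₀ fun p hp ↦ ?_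
  by_cases hpN : p ∣ W.conductorNorm ℤ
  · by_cases hp2 : p ^ 2 ∣ W.conductorNorm ℤ
    · -- additive prime: `a_p(f₀) = 0 = a_p(W)`
      rw [hf₀.cuspCoeff_eq_zero_of_sq_dvd hp hp2]
      haveI : Fact p.Prime := ⟨hp⟩
      set w : HeightOneSpectrum (𝓞 ℚ) := (primesEquiv (R := 𝓞 ℚ)).symm ⟨p, hp⟩ with hw
      have hpw : (primesEquiv w : Nat.Primes) = ⟨p, hp⟩ := Equiv.apply_symm_apply _ _
      have hgen : natGenerator ((primesEquiv (R := ℤ)).symm (primesEquiv w)) = p := by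
        rw [hpw]
        exact congrArg (fun x : Nat.Primes ↦ (x : ℕ))
          (Equiv.apply_symm_apply (primesEquiv (R := ℤ)) ⟨p, hp⟩)
      have h2f : 2 ≤ W.conductorExponent w := by
        have h1 : 2 ≤ (W.conductorNorm ℤ).factorization p :=
          (hp.pow_dvd_iff_le_factorization (NeZero.ne _)).mp hp2
        rw [W.conductorExponent_ringOfIntegers_eq w,
          ← W.factorization_conductorNorm_holds ((primesEquiv (R := ℤ)).symm (primesEquiv w)), hgen]
        exact h1
      have hadd : W.HasAdditiveReductionAt w := (two_le_conductorExponent_iff_holds w W).mp h2f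
      have hv : ((primesEquiv w : Nat.Primes) : ℕ) = p := by rw [hpw]
      rw [W.LFunction_apply_eq_zero_of_hasAdditiveReductionAt hv hadd (dvd_refl p), Int.cast_zero]
    · exact hsign p hp hpN hp2
  · exact hap p hp hpN

end Assembly

/-! ## L2 — the residual: the Steinberg sign bit at `p ∥ N` -/

/-- **L2 — `SteinbergSignPacket` (the ONLY Euler-factor datum S9 needs).**  For every elliptic `W/ℚ`
and every newform `f₀ ∈ S₂(Γ₀(N))` at level `N = N_W` carrying `a_p(W)` for `p ∤ N` with `W` good off
`N`: `a_p(f₀) = a_p(W)` at every prime `p ∥ N` — i.e. the Atkin–Lehner sign `-λ_p(f₀)` equals `+1` at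
split and `-1` at non-split multiplicative reduction.  In print: Darmon–Diamond–Taylor Thm. 3.1 (e),
first case ("`p ∥ N`, `p ∤ cond ψ`: `ρ|_{G_p} ~ (χε, *; 0, χ)`, `χ` unramified, `χ(Frob_p) = a_p`";
Deligne–Rapoport / Langlands / Carayol), read on `ρ = V_ℓ W`, whose unramified quotient at a
multiplicative `p` is the twist `δ` of the Tate curve with `δ(Frob_p) = a_p(W)`.  Invisible to
conductors (`a(V ⊗ ψ)` at `p` does not see `δ`), to quadratic twists and to the functional equation.
Implied by `Carayol1986_eulerFactor` (L2a).  On the Frey family `E_{a,b} : y² = x(x-a)(x+b)`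
(`a, b` coprime) at an odd `q ∣ ab(a+b)`: `a_q(E) = (b/q), (-a/q), (a/q)` for `q ∣ a`, `q ∣ b`,
`q ∣ a+b` (tangent-cone discriminants; kit job j344703: 11756 triples `|a|,|b| ≤ 40`, 0 mismatches, `v_q(N) = 1` throughout).
[cite: DarmonDiamondTaylor1995, Thm. 3.1 (e) (p. 86) and p. 87] [cite: CarayolASENS1986, Thm. (A)]
[cite: Knapp1993, Thm. 9.27] -/
def SteinbergSignPacket : Prop :=
  ∀ (W : WeierstrassCurve ℚ) [W.IsElliptic] {N : ℕ} [NeZero N] (f₀ : CuspForm (Gamma0 N) 2),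
    IsNewform0 f₀ → N = W.conductorNorm ℤ →
    (∀ v : HeightOneSpectrum (𝓞 ℚ), ¬ ((primesEquiv v : ℕ) ∣ N) → W.HasGoodReductionAt v) →
    (∀ p : ℕ, p.Prime → ¬ p ∣ N → cuspCoeff f₀ p = (W.LFunction p : ℂ)) →
    ∀ p : ℕ, p.Prime → p ∣ N → ¬ p ^ 2 ∣ N → cuspCoeff f₀ p = (W.LFunction p : ℂ)

/-- **L2a — the residual from Carayol's Euler-factor theorem** (C_E ⇒ sign bit): k1's PROVED
`isNewformOf_of_cofinalAt_of_carayolEuler hCE W f₀ hf₀ (T₀ := N) hap (ratGaloisRepCofinalAt_of_curve …)`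
(`STUB_IDEAS_stub_threeImpTwo_1_Sketch.lean`, ll. 967–1085) gives `IsNewformOf W f₀`, whose `.2 p` is
the sign; equivalently H3/H4 there at the single place `v ∣ p`.  Left `sorry` here only because crux-dir
companions are not importable; a prover lands it from that file (S, ≤ 15 lines over k1's B1∘B2).
[cite: CarayolASENS1986, Thm. (A)] [cite: DarmonDiamondTaylor1995, Thm. 3.1 (e)] -/
theorem steinbergSignPacket_of_carayol1986_eulerFactor (hCE : Carayol1986_eulerFactor) :
    SteinbergSignPacket := by
  sorry

/-! ## Closers (kernel-checked glue) -/

section Closers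

/-- **M3 recut: the packet IS the newform of `W`, and its level is `N_W`** — from Carayol (A), Saito's
leaf for `W`, and the Steinberg sign bit (no `Carayol1986_eulerFactor`, no Eichler–Shimura).
[cite: CarayolASENS1986, Thm. (A), (0.8) Corollaire] [cite: DarmonDiamondTaylor1995, Thm. 3.1 (d), (e)] -/
theorem isNewformOf_of_packet_of_carayol1986_of_saito_of_sign (hC : Carayol1986_artinConductorExponent)
    (hSign : SteinbergSignPacket) (W : WeierstrassCurve ℚ) [W.IsElliptic] [NeZero (W.conductorNorm ℤ)]
    (hS : ∀ (ℓ : ℕ) [Fact ℓ.Prime],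
      W.swanConductorAt_rationalTate_eq_wildConductorExponent_of_ringChar_eq_two ℓ)
    {N : ℕ} [NeZero N] (f₀ : CuspForm (Gamma0 N) 2) (hf₀ : IsNewform0 f₀)
    (hgood : ∀ v : HeightOneSpectrum (𝓞 ℚ), ¬ ((primesEquiv v : ℕ) ∣ N) → W.HasGoodReductionAt v)
    (hap : ∀ p : ℕ, p.Prime → ¬ p ∣ N → cuspCoeff f₀ p = (W.LFunction p : ℂ)) :
    IsNewformOf W f₀ ∧ N = W.conductorNorm ℤ := by
  have hN : N = W.conductorNorm ℤ :=
    level_eq_conductorNorm_of_carayol1986_of_saito_of_packet W f₀ hC hS hf₀ hgood hap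
  exact ⟨isNewformOf_of_packet_of_level_eq_of_sign W f₀ hf₀ hN hap
    (hSign W f₀ hf₀ hN hgood hap), hN⟩

/-- **(packet) ⇒ (2) `BCDT.IsModular W`** from {C_A, Saito leaf of `W`, SteinbergSignPacket}. Replaces
`isNewformOf_of_packet_off_level_of_carayolEuler hCE` + `hC` in k2 gen-4's
`isModular_of_isModularGaloisRepTate_two_primes` / `sigThreeImpTwoFreyCS_of_carayolEuler_of_freyLevel`.
[cite: BCDTJAMS2001, Introduction ((3) ⇒ (2))] -/
theorem isModular_of_packet_of_carayol1986_of_saito_of_sign (hC : Carayol1986_artinConductorExponent)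
    (hSign : SteinbergSignPacket) (W : WeierstrassCurve ℚ) [W.IsElliptic] [NeZero (W.conductorNorm ℤ)]
    (hS : ∀ (ℓ : ℕ) [Fact ℓ.Prime],
      W.swanConductorAt_rationalTate_eq_wildConductorExponent_of_ringChar_eq_two ℓ)
    {N : ℕ} [NeZero N] (f₀ : CuspForm (Gamma0 N) 2) (hf₀ : IsNewform0 f₀)
    (hgood : ∀ v : HeightOneSpectrum (𝓞 ℚ), ¬ ((primesEquiv v : ℕ) ∣ N) → W.HasGoodReductionAt v)
    (hap : ∀ p : ℕ, p.Prime → ¬ p ∣ N → cuspCoeff f₀ p = (W.LFunction p : ℂ)) :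
    BCDT.IsModular W := by
  obtain ⟨hWf, hN⟩ :=
    isNewformOf_of_packet_of_carayol1986_of_saito_of_sign hC hSign W hS f₀ hf₀ hgood hap
  subst hN
  exact ⟨f₀, hWf⟩

/-- **The realisation leaf in packet shape** (`hPk`): a modular `ρ_{W,ℓ}` yields the a.e. packet OFF ITS
LEVEL (hole at `ℓ` filled).  k2 gen 4 PROVES it under the compatible-system cut from two primes
(`exists_isNewform0_packet_off_level_of_two_primes`); k1 reduces the single-prime version to
Eichler–Shimura-weak / CR + hole-filler. [cite: BCDTJAMS2001, Introduction ((3) ⇒ (2))] -/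
def SomeLevelPacket : Prop :=
  ∀ (W : WeierstrassCurve ℚ) [W.IsElliptic] (ℓ : ℕ) [Fact ℓ.Prime], W.IsModularGaloisRepTate ℓ →
    ∃ (N : ℕ) (_ : NeZero N) (f₀ : CuspForm (Gamma0 N) 2), IsNewform0 f₀ ∧
      (∀ v : HeightOneSpectrum (𝓞 ℚ), ¬ ((primesEquiv v : ℕ) ∣ N) → W.HasGoodReductionAt v) ∧
      ∀ p : ℕ, p.Prime → ¬ p ∣ N → cuspCoeff f₀ p = (W.LFunction p : ℂ)

/-- **Plan closer — the VERBATIM stub `stub_threeImpTwo` from the four leaves**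
{`SomeLevelPacket`, Carayol (A), Saito's `p = 2` leaf (all curves; ⇐ gen-4 k3's `SaitoTwoSupersingular`
by `saito_two_of_saitoTwoSupersingular`), `SteinbergSignPacket`}.
[cite: BCDTJAMS2001, Introduction ((3) ⇒ (2))] [cite: CarayolASENS1986, Thm. (A)] -/
theorem stub_threeImpTwo_of_packet_leaves (hPk : SomeLevelPacket)
    (hC : Carayol1986_artinConductorExponent)
    (hS : ∀ (V : WeierstrassCurve ℚ) (ℓ : ℕ) [Fact ℓ.Prime],
      V.swanConductorAt_rationalTate_eq_wildConductorExponent_of_ringChar_eq_two ℓ)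
    (hSign : SteinbergSignPacket) :
    ∀ (W : WeierstrassCurve ℚ) [W.IsElliptic] [NeZero (W.conductorNorm ℤ)] (ℓ : ℕ) [Fact ℓ.Prime],
      W.IsModularGaloisRepTate ℓ → BCDT.IsModular W := by
  intro W _ _ ℓ _ h
  obtain ⟨N, hN, f₀, hf₀, hgood, hap⟩ := hPk W ℓ h
  exact isModular_of_packet_of_carayol1986_of_saito_of_sign hC hSign W (hS W) f₀ hf₀ hgood hap

end Closers

end Summit.ABC.ABC.Cruxes.FreyModularity.Sketch.ThreeImpTwoIdeas3g5

end
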